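import Mathlib.Analysis.Normed.Operator.ContinuousLinearMap
import Mathlib.Analysis.Normed.Module.Basic
import Mathlib.Topology.Algebra.Module.ContinuousLinearMap.PiProd
import HarnessLib

/-!
# The fibre block of a nearly block-triangular injective linear map

Topic `Literature/Topology/FourManifolds`; linear-algebra input of the first reading in the
secant-affine charts of the smoothing of PD homeomorphisms (Munkres, Ann. of Math. 72 (1960), §5).
At a point of the (flat) axis of a tube, the derivative `L = Du (x, 0)` of the sector model
`u = (T, N) : E × F → E × F` is injective with a quantitative bound `‖z‖ ≤ κ ‖L z‖`, its block
`D_x N` is small (`‖(L (v, 0)).2‖ ≤ ε₁ ‖v‖`, the model maps the source secant simplex almost onto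
the target one), `D_x T` has a bounded right inverse and `D_y T` is bounded.  Then the fibre block
`D_y N : w ↦ (L (0, w)).2` is quantitatively injective:

  `(1 − κ ε₁ π₀ θ₀) ‖w‖ ≤ κ ‖(L (0, w)).2‖`   (`fibre_block_lower_bound`).

This is the hypothesis `hm` of `TubeFirstReading(Offset).lean`.  Pure normed-space algebra; no
definitions, no named facts.

## References

* J. R. Munkres, *Obstructions to the smoothing of piecewise-differentiable homeomorphisms*, Ann.
  of Math. (2) 72 (1960), 521–554, §5. [Munkres1960]
-/

noncomputable section

open Set Function

namespace Literature.Topology.FourManifolds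

variable {E : Type*} [NormedAddCommGroup E] [NormedSpace ℝ E]
variable {F : Type*} [NormedAddCommGroup F] [NormedSpace ℝ F]

/-- Splitting of `L (v, w)` into the two partial applications. [folklore] -/
theorem apply_prod_eq_add (L : (E × F) →L[ℝ] E × F) (v : E) (w : F) : L (v, w) = L (v, 0) + L (0, w) := by
  rw [← map_add]; congr 1; ext <;> simp

/-- **The fibre block of a nearly block-triangular injective map is injective, quantitatively.**
If `‖z‖ ≤ κ ‖L z‖` for all `z`, `‖(L (v, 0)).2‖ ≤ ε₁ ‖v‖` (small lower-left block), `P` is a right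
inverse of the upper-left block (`(L (P e, 0)).1 = e`) with `‖P e‖ ≤ π₀ ‖e‖`, and
`‖(L (0, w)).1‖ ≤ θ₀ ‖w‖` (bounded upper-right block), then
`(1 − κ ε₁ π₀ θ₀) ‖w‖ ≤ κ ‖(L (0, w)).2‖`. [folklore] -/
theorem fibre_block_lower_bound (L : (E × F) →L[ℝ] E × F) {κ ε₁ π₀ θ₀ : ℝ} (hκ0 : 0 ≤ κ) (hε0 : 0 ≤ ε₁)
    (hπ0 : 0 ≤ π₀) (hκ : ∀ z : E × F, ‖z‖ ≤ κ * ‖L z‖) (hε : ∀ v : E, ‖(L (v, 0)).2‖ ≤ ε₁ * ‖v‖)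
    {P : E → E} (hP : ∀ e : E, (L (P e, 0)).1 = e) (hP' : ∀ e : E, ‖P e‖ ≤ π₀ * ‖e‖)
    (hθ : ∀ w : F, ‖(L (0, w)).1‖ ≤ θ₀ * ‖w‖) (w : F) :
    (1 - κ * ε₁ * π₀ * θ₀) * ‖w‖ ≤ κ * ‖(L (0, w)).2‖ := by
  -- the correcting tangential vector
  set v : E := P ((L (0, w)).1) with hv
  have hv1 : (L (v, 0)).1 = (L (0, w)).1 := hP _
  have hvn : ‖v‖ ≤ π₀ * θ₀ * ‖w‖ :=
    calc ‖v‖ ≤ π₀ * ‖(L (0, w)).1‖ := hP' _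
      _ ≤ π₀ * (θ₀ * ‖w‖) := mul_le_mul_of_nonneg_left (hθ w) hπ0
      _ = π₀ * θ₀ * ‖w‖ := by ring
  -- the key vector `(-v, w)` has image `(0, (L(0,w)).2 - (L(v,0)).2)`
  have himg : L (-v, w) = (0, (L (0, w)).2 - (L (v, 0)).2) := by
    have e1 : ((-v, w) : E × F) = (0, w) - (v, 0) := by ext <;> simp
    rw [e1, map_sub]
    ext
    · simp [hv1]
    · simp
  have h1 := hκ (-v, w)
  rw [himg] at h1
  have h2 : ‖w‖ ≤ ‖((-v, w) : E × F)‖ := norm_snd_le ((-v, w) : E × F)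
  have h3 : ‖((0 : E), (L (0, w)).2 - (L (v, 0)).2)‖ = ‖(L (0, w)).2 - (L (v, 0)).2‖ := by
    simp [Prod.norm_def]
  rw [h3] at h1
  have h4 : ‖(L (0, w)).2 - (L (v, 0)).2‖ ≤ ‖(L (0, w)).2‖ + ε₁ * ‖v‖ :=
    (norm_sub_le _ _).trans (add_le_add le_rfl (hε v))
  have h5 : κ * (ε₁ * ‖v‖) ≤ κ * ε₁ * π₀ * θ₀ * ‖w‖ := by
    have h6 : ε₁ * ‖v‖ ≤ ε₁ * (π₀ * θ₀ * ‖w‖) := mul_le_mul_of_nonneg_left hvn hε0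
    have h7 := mul_le_mul_of_nonneg_left h6 hκ0
    linarith
  calc (1 - κ * ε₁ * π₀ * θ₀) * ‖w‖ = ‖w‖ - κ * ε₁ * π₀ * θ₀ * ‖w‖ := by ring
    _ ≤ κ * (‖(L (0, w)).2‖ + ε₁ * ‖v‖) - κ * ε₁ * π₀ * θ₀ * ‖w‖ := by
        linarith [h2.trans (h1.trans (mul_le_mul_of_nonneg_left h4 hκ0))]
    _ ≤ κ * ‖(L (0, w)).2‖ := by linarith

end Literature.Topology.FourManifolds
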